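import Summits.QuantumFields.BalabanUV.Beta.GAN24.DerivativeRateTransferAccretive

/-!
# `BalabanUV.Beta.GAN24.DerivativeRateTransferAccretiveBound` — binder row G-an2-4 ∕ (CONV-C), route R6 «VALUES, NOT DERIVATIVES», PART 36:
# «ACCRETIVE S2» IN COMPLEX LETTERS, II — the sector letter `±K ≤ κ·A` as a product bound at a complex vector, the two-sided squeeze
# `Re 𝒮_{Â+iK̂}(b,b) ≤ (2+κ²)·𝒮_A(b,b)`, S2's entry bound `‖𝒮_{Â+iK̂}(a,b)‖ ≤ (1 + κ√(2+κ²))·Λ` from REAL-POINT letters (row bound `Λ` of `𝒮_A`), its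
# massless ∕ gauge-degenerate form through an2's `a`-shift, and the affine two-jet letters (unit b2b-balaban-gan24-p3, gen 39; gan24-idea-1 g45's lens item
# «ACCRETIVE S2» (Q)∕(B)∕(A′), scratch `AccretiveEffFormSketch` 600f412275675657, re-typed DIRECTLY OVER `ℂ`; v1.1 = v1 + §4 the LOWER comparison (L), appended)

NOT IN PRINT; OUR PROOF (for the ROUTE; [folklore] — PART 35 `isUnit_det_kkt_accretive` ∕ `effForm_accretive_apply` ∕ `re_effForm_accretive_diag`, PART 29
`abs_effForm_apply_le_of_form_le`, an2's `effForm_add_conj` and the kernel node's `det_kkt_add_conj` BY NAME; the discriminant (`discrim_le_zero`)).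
HONEST FRAMING (cell contract, verbatim): «discharging `BetaPertH` makes Bałaban's UV stability UNCONDITIONAL — a real constructive-QFT result; it is
NOT the continuum limit and NOT the Clay problem.»  HONEST DEPENDENCY (verbatim): «continuum YM on T⁴ ⇐ BetaPertH ∧ nine spine estimates (0/9 proved);
BetaPertH ⇐ (D1) ∧ (D4) ∧ CAP+tail; G-an2-4 gates asym, D1 and NE2/3/4.»

WHY THIS FILE.  PART 35 reduced S2's two letters for an accretive datum `(Â + i•K̂, Q̂)` (real PSD `A`, real symmetric `K`, real `Q`) to identities:
`hdet` holds outright, `𝒮(a,b) = 𝒮_A(a,b) + i·(w_a·K̂u_b)` and `Re 𝒮(b,b) = Re ū_b·Âu_b =: X_b`.  Here the SECTOR LETTER `±K ≤ κA` (Loewner) enters: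
§1 turns it into the product bound `(p·Kq)² ≤ κ²(p·Ap)(q·Aq)` (for all `s`, `0 ≤ (sp+q)ᵀ(κA−K)(sp+q) + (sp−q)ᵀ(κA+K)(sp−q) = 2κ(p·Ap)s² − 4(p·Kq)s +
2κ(q·Aq)`, discriminant) and, for REAL `w` and complex `u = x + iy`, into `‖ŵ·K̂u‖² = (w·Kx)² + (w·Ky)² ≤ κ²(w·Aw)(x·Ax + y·Ay) = κ²(w·Aw)·Re ū·Âu`;
§2 reads PART 35 (X) at `(b,b)`: `X_b = 𝒮_A(b,b) − Im(w_b·K̂u_b) ≤ e_b + ‖c‖`, `‖c‖² ≤ κ²e_bX_b`, so `2‖c‖ ≤ κ²e_b + X_b` (AM–GM, no square roots) and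
`X_b ≤ (2+κ²)e_b`; then `‖𝒮(a,b)‖ ≤ |𝒮_A(a,b)| + ‖c_{ab}‖ ≤ Λ + √(κ²·Λ·(2+κ²)Λ) = (1 + κ√(2+κ²))·Λ` — the constant of gan24-idea-1 g45's (B), now for
the COMPLEX effective form PART 32 END consumes; §2 (A′) measures `κ` and `Λ` against `A + a·QᵀQ` (positive definite whenever `kkt(A,Q)` is
nonsingular — the letter is never vacuous) at the price `+ a` twice; §3 supplies the dictionary for the affine two-jet family: `Ĥ + z₁Ĥ₁ + z₂Ĥ₂ =
Â(Re z) + i•K̂(Im z)` and `±H_i ≤ c·A ⟹ ±((Im z₁)H₁ + (Im z₂)H₂) ≤ 2ηc·A` on `|Im z_i| ≤ η` (cone combination).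

WHAT THIS FILE PROVES (0 sorry, 0 `def`, nothing cited):
* §1 **`cross_sq_le_of_loewner`** (`±K ≤ κA ⟹ (p·Kq)² ≤ κ²(p·Ap)(q·Aq)`), `ofReal_dotProduct_map_mulVec`, **`norm_sq_cross_le`** (`‖ŵ·K̂u‖² ≤ κ²(w·Aw)·Re ū·Âu`).
* §2 **`re_effForm_accretive_diag_le`** ((Q): `Re 𝒮_{Â+iK̂}(b,b) ≤ (2+κ²)·𝒮_A(b,b)`, every `κ`), **`norm_effForm_accretive_apply_le`** ((B):
  `‖𝒮_{Â+iK̂}(a,b)‖ ≤ (1 + κ√(2+κ²))·Λ`), `map_add_conj_eq`, **`norm_effForm_accretive_apply_le_of_reg`** ((A′): `≤ (1 + κ√(2+κ²))·(Λ + a) + a` with the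
  letters of `A + Qᵀ(a·1)Q`).
* §3 `affine₂_map_eq_accretive`, **`loewner_of_jet_letters`**.
* §4 (v1.1, appended) **`re_effForm_accretive_diag_ge`** ((L): `𝒮_A(b,b) ≤ Re 𝒮_{Â+iK̂}(b,b)` — with (Q) the two-sided squeeze
  `𝒮_A(b,b) ≤ Re 𝒮(b,b) ≤ (2+κ²)·𝒮_A(b,b)`; gan24-idea-1 g45's (L) over `ℂ`: the complex minimiser is `Â`-admissible and Rayleigh–Ritz holds for the Hermitian form `Â`).
WHAT IT DOES NOT DO: the Q-JETS (see PART 35); the sector letter `±H_iₖ ≤ c·(H_k(s,t) + aQ_kᵀQ_k)`, k-uniform on the real bidisc, and `Λ` for any of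
Bałaban's operators (an1 g73 W-4: «A NEW ROW», not a row of the (1.67) tables; at `U = 1` the γ₀ half is an5's `ineq167_lower`); S2(ii).  SUPPLIER work
on route R6 (rank 2, REDUCTION, no seat); no consumer of record; NEVER «G-an2-4 closed»; NOT (CONV-C), NOT D1, NOT `BetaPertH`, NOT continuum, NOT Clay.
Records: `HOME/b2b-balaban-gan24-p3/WOODBURY-FIBRE.md` v13.9.
-/

noncomputable section

open Matrix
open scoped ComplexOrder

namespace Summit.QuantumFields.BalabanUV.Beta.GAN24.DerivativeRateTransferAccretiveBound

open Literature.MathematicalPhysics.QuantumFieldTheory.Balaban1983to89.Beta.Composition (kkt)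
open Literature.MathematicalPhysics.QuantumFieldTheory.Balaban1983to89.Beta.CompositionSingular (effForm minOp effForm_add_conj)
open Literature.MathematicalPhysics.QuantumFieldTheory.Balaban1983to89.Beta.KKTSplit (det_kkt_add_conj)
open Summit.QuantumFields.BalabanUV.Beta.GAN24.DerivativeRateTransferLoewnerKKT (dotProduct_effForm_eq_energy transpose_eq_of_posSemidef
  single_dotProduct_mulVec_single)
open Summit.QuantumFields.BalabanUV.Beta.GAN24.DerivativeRateTransferSqueeze (abs_effForm_apply_le_of_form_le)
open Summit.QuantumFields.BalabanUV.Beta.GAN24.DerivativeRateTransferAccretive (eq_re_add_im ofReal_mulVec ofReal_dotProduct re_star_dotProduct_map_mulVec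
  posSemidef_map_ofReal transpose_map_ofReal minOp_map_single isUnit_det_kkt_accretive effForm_accretive_apply re_effForm_accretive_diag)

/-! ## §1 The sector letter as a product bound, real and complex -/

section Sector

variable {ν μ : Type*} [Fintype ν] [Fintype μ] [DecidableEq ν] [DecidableEq μ]
variable {A K : Matrix ν ν ℝ} {Q : Matrix μ ν ℝ} {κ Λ : ℝ}

omit [Fintype μ] [DecidableEq ν] [DecidableEq μ] in
/-- **`cross_sq_le_of_loewner` — THE REAL SECTOR LETTER AS A PRODUCT BOUND** [folklore; discriminant]: `κA − K ≥ 0`, `κA + K ≥ 0` (Loewner), `K`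
symmetric ⟹ `(p·Kq)² ≤ κ²·(p·Ap)·(q·Aq)`.  (For all `s`: `0 ≤ (sp+q)ᵀ(κA−K)(sp+q) + (sp−q)ᵀ(κA+K)(sp−q) = 2κ(p·Ap)s² − 4(p·Kq)s + 2κ(q·Aq)`.) -/
theorem cross_sq_le_of_loewner (hK : Kᵀ = K) (hKm : (κ • A - K).PosSemidef) (hKp : (κ • A + K).PosSemidef) (p q : ν → ℝ) :
    (p ⬝ᵥ (K *ᵥ q)) ^ 2 ≤ κ ^ 2 * (p ⬝ᵥ (A *ᵥ p)) * (q ⬝ᵥ (A *ᵥ q)) := by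
  have hqKp : q ⬝ᵥ (K *ᵥ p) = p ⬝ᵥ (K *ᵥ q) := by rw [dotProduct_mulVec, ← mulVec_transpose, hK, dotProduct_comm]
  have hquad : ∀ s : ℝ, 0 ≤ 2 * κ * (p ⬝ᵥ (A *ᵥ p)) * (s * s) + (-(4 * (p ⬝ᵥ (K *ᵥ q)))) * s + 2 * κ * (q ⬝ᵥ (A *ᵥ q)) := by
    intro s
    have e1 := hKm.dotProduct_mulVec_nonneg (s • p + q)
    have e2 := hKp.dotProduct_mulVec_nonneg (s • p - q)
    simp only [star_trivial] at e1 e2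
    have expand : (s • p + q) ⬝ᵥ ((κ • A - K) *ᵥ (s • p + q)) + (s • p - q) ⬝ᵥ ((κ • A + K) *ᵥ (s • p - q)) =
        2 * κ * (p ⬝ᵥ (A *ᵥ p)) * (s * s) + (-(4 * (p ⬝ᵥ (K *ᵥ q)))) * s + 2 * κ * (q ⬝ᵥ (A *ᵥ q)) := by
      simp only [sub_mulVec, add_mulVec, smul_mulVec, mulVec_add, mulVec_sub, mulVec_smul, dotProduct_add, dotProduct_sub,
        dotProduct_smul, add_dotProduct, sub_dotProduct, smul_dotProduct, smul_eq_mul, hqKp]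
      ring
    linarith [expand]
  have hd := discrim_le_zero hquad
  rw [discrim] at hd
  nlinarith [hd]

omit [Fintype μ] [DecidableEq ν] [DecidableEq μ] in
/-- [folklore] the real and imaginary parts of the complex cross pairing `ŵ·K̂u` for REAL `w`: `(w·K(Re u))` and `(w·K(Im u))`. -/
theorem ofReal_dotProduct_map_mulVec (N : Matrix ν ν ℝ) (w : ν → ℝ) (u : ν → ℂ) :
    (fun i => (w i : ℂ)) ⬝ᵥ (N.map (Complex.ofRealHom : ℝ →+* ℂ) *ᵥ u) =
      ((w ⬝ᵥ (N *ᵥ fun i => (u i).re) : ℝ) : ℂ) + Complex.I * ((w ⬝ᵥ (N *ᵥ fun i => (u i).im) : ℝ) : ℂ) := by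
  conv_lhs => rw [eq_re_add_im u]
  rw [mulVec_add, mulVec_smul, dotProduct_add, dotProduct_smul, ofReal_mulVec, ofReal_mulVec, ofReal_dotProduct, ofReal_dotProduct,
    smul_eq_mul]

omit [DecidableEq ν] in
/-- **`norm_sq_cross_le` — THE SECTOR LETTER AT A COMPLEX VECTOR** [our proof]: for REAL `w` and complex `u`,
`‖ŵ·K̂u‖² ≤ κ²·(w·Aw)·Re(ū·Âu)` (`‖α + iβ‖² = α² + β²`, the product bound for `α = w·K(Re u)`, `β = w·K(Im u)`, and `Re ū·Âu = x·Ax + y·Ay`). -/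
theorem norm_sq_cross_le (hK : Kᵀ = K) (hKm : (κ • A - K).PosSemidef) (hKp : (κ • A + K).PosSemidef) (w : ν → ℝ) (u : ν → ℂ) :
    ‖(fun i => (w i : ℂ)) ⬝ᵥ (K.map (Complex.ofRealHom : ℝ →+* ℂ) *ᵥ u)‖ ^ 2 ≤
      κ ^ 2 * (w ⬝ᵥ (A *ᵥ w)) * (star u ⬝ᵥ (A.map (Complex.ofRealHom : ℝ →+* ℂ) *ᵥ u)).re := by
  rw [ofReal_dotProduct_map_mulVec, re_star_dotProduct_map_mulVec, Complex.sq_norm, Complex.normSq_apply]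
  have hα := cross_sq_le_of_loewner hK hKm hKp w (fun i => (u i).re)
  have hβ := cross_sq_le_of_loewner hK hKm hKp w (fun i => (u i).im)
  simp only [Complex.add_re, Complex.add_im, Complex.ofReal_re, Complex.ofReal_im, Complex.mul_re, Complex.mul_im, Complex.I_re,
    Complex.I_im, zero_mul, one_mul, zero_add, sub_zero, add_zero, mul_zero]
  nlinarith [hα, hβ]

/-! ## §2 The two-sided squeeze, the entry bound, the massless case -/

/-- **(Q) `re_effForm_accretive_diag_le` — THE TWO-SIDED SQUEEZE ON THE DIAGONAL** [our proof; gan24-idea-1 g45 (Q) over `ℂ`]: `A` PSD, `K` symmetric with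
`±K ≤ κA`, `kkt(A,Q)` nonsingular ⟹ `Re 𝒮_{Â+iK̂}(b,b) ≤ (2 + κ²)·𝒮_A(b,b)` — NON-PERTURBATIVE in `K`: every `κ`. -/
theorem re_effForm_accretive_diag_le (hA : A.PosSemidef) (hK : Kᵀ = K) (h : IsUnit (kkt A Q).det)
    (hKm : (κ • A - K).PosSemidef) (hKp : (κ • A + K).PosSemidef) (b : μ) :
    (effForm (A.map (Complex.ofRealHom : ℝ →+* ℂ) + Complex.I • K.map (Complex.ofRealHom : ℝ →+* ℂ)) (Q.map (Complex.ofRealHom : ℝ →+* ℂ)) b b).re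
      ≤ (2 + κ ^ 2) * effForm A Q b b := by
  set Ac := A.map (Complex.ofRealHom : ℝ →+* ℂ) with hAc
  set Kc := K.map (Complex.ofRealHom : ℝ →+* ℂ) with hKc
  set Qc := Q.map (Complex.ofRealHom : ℝ →+* ℂ) with hQc
  have hM : IsUnit (kkt (Ac + Complex.I • Kc) Qc).det := isUnit_det_kkt_accretive hA hK h
  set u := minOp (Ac + Complex.I • Kc) Qc *ᵥ Pi.single b 1 with hu
  set wr : ν → ℝ := minOp A Q *ᵥ Pi.single b 1 with hwr
  set X := (star u ⬝ᵥ (Ac *ᵥ u)).re with hXdef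
  set e := effForm A Q b b with hedef
  -- the real diagonal value is the `A`-energy of the real minimiser
  have he : wr ⬝ᵥ (A *ᵥ wr) = e := by rw [hedef, ← single_dotProduct_mulVec_single (effForm A Q) b, dotProduct_effForm_eq_energy h]
  have he0 : 0 ≤ e := by
    rw [← he]; have := hA.dotProduct_mulVec_nonneg wr; simpa only [star_trivial] using this
  have hX0 : 0 ≤ X := by
    have := (posSemidef_map_ofReal hA).dotProduct_mulVec_nonneg u
    exact (Complex.nonneg_iff.mp this).1
  -- (V): `Re 𝒮(b,b) = X`; (X) at `(b,b)`: `𝒮(b,b) = e + i·c`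
  have hV : (effForm (Ac + Complex.I • Kc) Qc b b).re = X := re_effForm_accretive_diag hK hM b
  have hXe := effForm_accretive_apply (K := K) hA h hM b b
  rw [← hAc, ← hKc, ← hQc, minOp_map_single h b, ← hwr, ← hu] at hXe
  set c := (fun i => (wr i : ℂ)) ⬝ᵥ (Kc *ᵥ u) with hc
  have hXle : X ≤ e + ‖c‖ := by
    have h1 : (effForm (Ac + Complex.I • Kc) Qc b b).re = e + (Complex.I * c).re := by
      rw [hXe, Complex.add_re, Complex.ofReal_re]
    have h2 : (Complex.I * c).re = -c.im := by simp [Complex.mul_re]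
    have h3 : -c.im ≤ ‖c‖ := by have := Complex.abs_im_le_norm c; rw [abs_le] at this; linarith [this.1]
    linarith [hV, h1, h2, h3]
  have hc2 : ‖c‖ ^ 2 ≤ κ ^ 2 * e * X := by rw [← he]; exact norm_sq_cross_le hK hKm hKp wr u
  -- `2‖c‖ ≤ κ²e + X` (AM–GM without square roots), hence `X ≤ e + (κ²e + X)/2`
  have hcc : 2 * ‖c‖ ≤ κ ^ 2 * e + X := by
    have hsq : (2 * ‖c‖) ^ 2 ≤ (κ ^ 2 * e + X) ^ 2 := by nlinarith [hc2, sq_nonneg (κ ^ 2 * e - X)]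
    have hpos : 0 ≤ κ ^ 2 * e + X := by positivity
    have := abs_le_of_sq_le_sq hsq hpos
    rwa [abs_of_nonneg (by positivity : (0 : ℝ) ≤ 2 * ‖c‖)] at this
  rw [hV]
  linarith

/-- **(B) `norm_effForm_accretive_apply_le` — S2's `B` FROM THE REAL-POINT LETTERS** [our proof; gan24-idea-1 g45 (B) over `ℂ`]: `A` PSD, `K` symmetric,
`±K ≤ κA` (`0 ≤ κ`), `kkt(A,Q)` nonsingular, `⟨w,𝒮_A w⟩ ≤ Λ|w|²` ⟹ `‖𝒮_{Â+iK̂}(a,b)‖ ≤ (1 + κ√(2+κ²))·Λ`. -/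
theorem norm_effForm_accretive_apply_le (hA : A.PosSemidef) (hK : Kᵀ = K) (h : IsUnit (kkt A Q).det) (hκ : 0 ≤ κ)
    (hKm : (κ • A - K).PosSemidef) (hKp : (κ • A + K).PosSemidef) (hΛ : ∀ w : μ → ℝ, w ⬝ᵥ (effForm A Q *ᵥ w) ≤ Λ * (w ⬝ᵥ w)) (a b : μ) :
    ‖effForm (A.map (Complex.ofRealHom : ℝ →+* ℂ) + Complex.I • K.map (Complex.ofRealHom : ℝ →+* ℂ)) (Q.map (Complex.ofRealHom : ℝ →+* ℂ)) a b‖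
      ≤ (1 + κ * Real.sqrt (2 + κ ^ 2)) * Λ := by
  set Ac := A.map (Complex.ofRealHom : ℝ →+* ℂ) with hAc
  set Kc := K.map (Complex.ofRealHom : ℝ →+* ℂ) with hKc
  set Qc := Q.map (Complex.ofRealHom : ℝ →+* ℂ) with hQc
  have hM : IsUnit (kkt (Ac + Complex.I • Kc) Qc).det := isUnit_det_kkt_accretive hA hK h
  set u := minOp (Ac + Complex.I • Kc) Qc *ᵥ Pi.single b 1 with hu
  set wr : ν → ℝ := minOp A Q *ᵥ Pi.single a 1 with hwr
  -- the diagonal letters `e_a = 𝒮_A(a,a) ≤ Λ`, `X_b ≤ (2+κ²)𝒮_A(b,b) ≤ (2+κ²)Λ`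
  have hdiag : ∀ y : μ, effForm A Q y y ≤ Λ := fun y => by
    have h1 := hΛ (Pi.single y 1)
    rwa [single_dotProduct_mulVec_single, show Pi.single y (1 : ℝ) ⬝ᵥ Pi.single y 1 = 1 by simp, mul_one] at h1
  have hea : wr ⬝ᵥ (A *ᵥ wr) = effForm A Q a a := by rw [← single_dotProduct_mulVec_single (effForm A Q) a, dotProduct_effForm_eq_energy h]
  have hea0 : 0 ≤ effForm A Q a a := by
    rw [← hea]; have := hA.dotProduct_mulVec_nonneg wr; simpa only [star_trivial] using this
  have hΛ0 : 0 ≤ Λ := hea0.trans (hdiag a)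
  have hX : (star u ⬝ᵥ (Ac *ᵥ u)).re ≤ (2 + κ ^ 2) * Λ := by
    have h1 := re_effForm_accretive_diag_le (Q := Q) hA hK h hKm hKp b
    rw [re_effForm_accretive_diag hK hM b] at h1
    exact h1.trans (mul_le_mul_of_nonneg_left (hdiag b) (by positivity))
  -- (X): `𝒮(a,b) = 𝒮_A(a,b) + i·c`, `‖c‖² ≤ κ²·e_a·X_b ≤ κ²(2+κ²)Λ²`
  have hXe := effForm_accretive_apply (K := K) hA h hM a b
  rw [← hAc, ← hKc, ← hQc, minOp_map_single h a, ← hwr, ← hu] at hXe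
  set c := (fun i => (wr i : ℂ)) ⬝ᵥ (Kc *ᵥ u) with hc
  have hc2 : ‖c‖ ^ 2 ≤ (κ * Real.sqrt (2 + κ ^ 2) * Λ) ^ 2 := by
    have h1 : ‖c‖ ^ 2 ≤ κ ^ 2 * (wr ⬝ᵥ (A *ᵥ wr)) * (star u ⬝ᵥ (Ac *ᵥ u)).re := norm_sq_cross_le hK hKm hKp wr u
    have h2 : (κ * Real.sqrt (2 + κ ^ 2) * Λ) ^ 2 = κ ^ 2 * Λ * ((2 + κ ^ 2) * Λ) := by
      rw [mul_pow, mul_pow, Real.sq_sqrt (by positivity)]; ring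
    rw [h2, hea] at *
    have hX0 : 0 ≤ (star u ⬝ᵥ (Ac *ᵥ u)).re := (Complex.nonneg_iff.mp ((posSemidef_map_ofReal hA).dotProduct_mulVec_nonneg u)).1
    calc ‖c‖ ^ 2 ≤ κ ^ 2 * effForm A Q a a * (star u ⬝ᵥ (Ac *ᵥ u)).re := h1
      _ ≤ κ ^ 2 * Λ * (star u ⬝ᵥ (Ac *ᵥ u)).re := mul_le_mul_of_nonneg_right (mul_le_mul_of_nonneg_left (hdiag a) (sq_nonneg κ)) hX0
      _ ≤ κ ^ 2 * Λ * ((2 + κ ^ 2) * Λ) := mul_le_mul_of_nonneg_left hX (by positivity)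
  have hcle : ‖c‖ ≤ κ * Real.sqrt (2 + κ ^ 2) * Λ := by
    have := abs_le_of_sq_le_sq hc2 (by positivity)
    rwa [abs_of_nonneg (norm_nonneg c)] at this
  have hre : ‖((effForm A Q a b : ℝ) : ℂ)‖ ≤ Λ := by
    rw [Complex.norm_real, Real.norm_eq_abs]; exact abs_effForm_apply_le_of_form_le hA h hΛ a b
  calc ‖effForm (Ac + Complex.I • Kc) Qc a b‖ = ‖((effForm A Q a b : ℝ) : ℂ) + Complex.I * c‖ := by rw [hXe]
    _ ≤ ‖((effForm A Q a b : ℝ) : ℂ)‖ + ‖Complex.I * c‖ := norm_add_le _ _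
    _ = ‖((effForm A Q a b : ℝ) : ℂ)‖ + ‖c‖ := by rw [norm_mul, Complex.norm_I, one_mul]
    _ ≤ Λ + κ * Real.sqrt (2 + κ ^ 2) * Λ := add_le_add hre hcle
    _ = (1 + κ * Real.sqrt (2 + κ ^ 2)) * Λ := by ring

omit [Fintype ν] [DecidableEq ν] in
/-- [folklore] the `a`-regularised fine form complexifies as expected: `(A + Qᵀ(a·1)Q)^ + i•K̂ = (Â + i•K̂) + Q̂ᵀ((a:ℂ)·1)Q̂`. -/
theorem map_add_conj_eq (A K : Matrix ν ν ℝ) (Q : Matrix μ ν ℝ) (a : ℝ) :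
    (A + Qᵀ * (a • (1 : Matrix μ μ ℝ)) * Q).map (Complex.ofRealHom : ℝ →+* ℂ) + Complex.I • K.map (Complex.ofRealHom : ℝ →+* ℂ) =
      (A.map (Complex.ofRealHom : ℝ →+* ℂ) + Complex.I • K.map (Complex.ofRealHom : ℝ →+* ℂ)) +
        (Q.map (Complex.ofRealHom : ℝ →+* ℂ))ᵀ * ((a : ℂ) • (1 : Matrix μ μ ℂ)) * Q.map (Complex.ofRealHom : ℝ →+* ℂ) := by
  have h1 : (a • (1 : Matrix μ μ ℝ)).map (Complex.ofRealHom : ℝ →+* ℂ) = (a : ℂ) • (1 : Matrix μ μ ℂ) := by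
    ext i j
    by_cases hij : i = j
    · subst hij; simp
    · simp [Matrix.one_apply_ne hij]
  rw [Matrix.map_add _ Complex.ofRealHom.map_add, Matrix.map_mul, Matrix.map_mul, h1, transpose_map_ofReal, add_right_comm]

/-- **(A′) `norm_effForm_accretive_apply_le_of_reg` — THE MASSLESS ∕ GAUGE-DEGENERATE CASE** [our proof; gan24-idea-1 g45 (A)∕(A′) over `ℂ`]: with the sector
letter and the row bound measured against the REGULARISED real form `A_a := A + Qᵀ(a·1)Q` (positive definite whenever `kkt(A,Q)` is nonsingular, so
`κ < ∞` always), `0 ≤ a`: `‖𝒮_{Â+iK̂}(x,y)‖ ≤ (1 + κ√(2+κ²))·(Λ + a) + a` — an2's `a`-shift `𝒮(M + Q̂ᵀ(a·1)Q̂, Q̂) = 𝒮(M,Q̂) + a·1` BY NAME. -/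
theorem norm_effForm_accretive_apply_le_of_reg {a : ℝ} (ha : 0 ≤ a) (hA : A.PosSemidef) (hK : Kᵀ = K) (h : IsUnit (kkt A Q).det)
    (hκ : 0 ≤ κ) (hKm : (κ • (A + Qᵀ * (a • (1 : Matrix μ μ ℝ)) * Q) - K).PosSemidef)
    (hKp : (κ • (A + Qᵀ * (a • (1 : Matrix μ μ ℝ)) * Q) + K).PosSemidef)
    (hΛ : ∀ w : μ → ℝ, w ⬝ᵥ (effForm A Q *ᵥ w) ≤ Λ * (w ⬝ᵥ w)) (x y : μ) :
    ‖effForm (A.map (Complex.ofRealHom : ℝ →+* ℂ) + Complex.I • K.map (Complex.ofRealHom : ℝ →+* ℂ)) (Q.map (Complex.ofRealHom : ℝ →+* ℂ)) x y‖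
      ≤ (1 + κ * Real.sqrt (2 + κ ^ 2)) * (Λ + a) + a := by
  set Aa := A + Qᵀ * (a • (1 : Matrix μ μ ℝ)) * Q with hAa
  have hQQ : (Qᵀ * (a • (1 : Matrix μ μ ℝ)) * Q).PosSemidef := by
    have e : Qᵀ * (a • (1 : Matrix μ μ ℝ)) * Q = a • (Qᴴ * Q) := by
      rw [conjTranspose_eq_transpose_of_trivial, Matrix.mul_smul, Matrix.mul_one, Matrix.smul_mul]
    rw [e]; exact (posSemidef_conjTranspose_mul_self Q).smul ha
  have hAa_psd : Aa.PosSemidef := hA.add hQQ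
  have hAa_det : IsUnit (kkt Aa Q).det := by rw [hAa, det_kkt_add_conj]; exact h
  have hΛa : ∀ w : μ → ℝ, w ⬝ᵥ (effForm Aa Q *ᵥ w) ≤ (Λ + a) * (w ⬝ᵥ w) := fun w => by
    rw [hAa, effForm_add_conj A Q _ h, add_mulVec, dotProduct_add, smul_mulVec, one_mulVec, dotProduct_smul, smul_eq_mul, add_mul]
    exact add_le_add (hΛ w) le_rfl
  have hB := norm_effForm_accretive_apply_le hAa_psd hK hAa_det hκ hKm hKp hΛa x y
  have hM : IsUnit (kkt (A.map (Complex.ofRealHom : ℝ →+* ℂ) + Complex.I • K.map (Complex.ofRealHom : ℝ →+* ℂ))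
      (Q.map (Complex.ofRealHom : ℝ →+* ℂ))).det := isUnit_det_kkt_accretive hA hK h
  rw [hAa, map_add_conj_eq, effForm_add_conj _ _ _ hM, Matrix.add_apply, Matrix.smul_apply, smul_eq_mul] at hB
  have hay : ‖(a : ℂ) * (1 : Matrix μ μ ℂ) x y‖ ≤ a := by
    rw [Matrix.one_apply]; split_ifs <;> simp [abs_of_nonneg ha, ha]
  calc ‖effForm (A.map (Complex.ofRealHom : ℝ →+* ℂ) + Complex.I • K.map (Complex.ofRealHom : ℝ →+* ℂ)) (Q.map (Complex.ofRealHom : ℝ →+* ℂ)) x y‖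
      = ‖(effForm (A.map (Complex.ofRealHom : ℝ →+* ℂ) + Complex.I • K.map (Complex.ofRealHom : ℝ →+* ℂ)) (Q.map (Complex.ofRealHom : ℝ →+* ℂ)) x y
          + (a : ℂ) * (1 : Matrix μ μ ℂ) x y) - (a : ℂ) * (1 : Matrix μ μ ℂ) x y‖ := by rw [add_sub_cancel_right]
    _ ≤ ‖effForm (A.map (Complex.ofRealHom : ℝ →+* ℂ) + Complex.I • K.map (Complex.ofRealHom : ℝ →+* ℂ)) (Q.map (Complex.ofRealHom : ℝ →+* ℂ)) x y
          + (a : ℂ) * (1 : Matrix μ μ ℂ) x y‖ + ‖(a : ℂ) * (1 : Matrix μ μ ℂ) x y‖ := norm_sub_le _ _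
    _ ≤ (1 + κ * Real.sqrt (2 + κ ^ 2)) * (Λ + a) + a := add_le_add hB hay

end Sector

/-! ## §3 The affine two-jet letters -/

section Affine

variable {ν : Type*} [Fintype ν] [DecidableEq ν]

omit [Fintype ν] [DecidableEq ν] in
/-- [folklore] **the complexified affine family IS an accretive datum**: `Ĥ + z₁Ĥ₁ + z₂Ĥ₂ = (H + (Re z₁)H₁ + (Re z₂)H₂)^ + i•((Im z₁)H₁ + (Im z₂)H₂)^`. -/
theorem affine₂_map_eq_accretive {m n : Type*} (H H₁ H₂ : Matrix m n ℝ) (z : ℂ × ℂ) :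
    H.map (Complex.ofRealHom : ℝ →+* ℂ) + z.1 • H₁.map (Complex.ofRealHom : ℝ →+* ℂ) + z.2 • H₂.map (Complex.ofRealHom : ℝ →+* ℂ) =
      (H + z.1.re • H₁ + z.2.re • H₂).map (Complex.ofRealHom : ℝ →+* ℂ) +
        Complex.I • (z.1.im • H₁ + z.2.im • H₂).map (Complex.ofRealHom : ℝ →+* ℂ) := by
  ext i j
  simp only [Matrix.add_apply, Matrix.smul_apply, Matrix.map_apply, Complex.ofRealHom_eq_coe, smul_eq_mul]
  apply Complex.ext
  · simp [Complex.mul_re]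
  · simp [Complex.mul_im]

omit [Fintype ν] [DecidableEq ν] in
/-- **`loewner_of_jet_letters` — THE SECTOR LETTER OF THE IMAGINARY JET PART FROM THE PER-JET LETTERS** [our proof]: `A` PSD, `±H₁ ≤ c·A`, `±H₂ ≤ c·A`,
`|y₁| ≤ η`, `|y₂| ≤ η` ⟹ `±(y₁H₁ + y₂H₂) ≤ (2ηc)·A` (cone combination: `(2ηc)A ∓ (y₁H₁ + y₂H₂) = Σ ((|y_i| ± y_i)∕2)·(cA ∓ H_i) + … + (2ηc − (|y₁|+|y₂|)c)·A`). -/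
theorem loewner_of_jet_letters {A H₁ H₂ : Matrix ν ν ℝ} {c η y₁ y₂ : ℝ} (hA : A.PosSemidef) (hc : 0 ≤ c)
    (hm₁ : (c • A - H₁).PosSemidef) (hq₁ : (c • A + H₁).PosSemidef) (hm₂ : (c • A - H₂).PosSemidef) (hq₂ : (c • A + H₂).PosSemidef)
    (hy₁ : |y₁| ≤ η) (hy₂ : |y₂| ≤ η) :
    ((2 * η * c) • A - (y₁ • H₁ + y₂ • H₂)).PosSemidef ∧ ((2 * η * c) • A + (y₁ • H₁ + y₂ • H₂)).PosSemidef := by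
  have ha₁ : 0 ≤ (|y₁| + y₁) / 2 := by linarith [neg_abs_le y₁]
  have hb₁ : 0 ≤ (|y₁| - y₁) / 2 := by linarith [le_abs_self y₁]
  have ha₂ : 0 ≤ (|y₂| + y₂) / 2 := by linarith [neg_abs_le y₂]
  have hb₂ : 0 ≤ (|y₂| - y₂) / 2 := by linarith [le_abs_self y₂]
  have hrest : 0 ≤ 2 * η * c - (|y₁| + |y₂|) * c := by nlinarith [abs_nonneg y₁, abs_nonneg y₂]
  constructor
  · have e : (2 * η * c) • A - (y₁ • H₁ + y₂ • H₂) =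
        ((|y₁| + y₁) / 2) • (c • A - H₁) + ((|y₁| - y₁) / 2) • (c • A + H₁) + ((|y₂| + y₂) / 2) • (c • A - H₂) +
          ((|y₂| - y₂) / 2) • (c • A + H₂) + (2 * η * c - (|y₁| + |y₂|) * c) • A := by
      ext i j; simp [Matrix.add_apply, Matrix.sub_apply, Matrix.smul_apply]; ring
    rw [e]
    exact ((((hm₁.smul ha₁).add (hq₁.smul hb₁)).add (hm₂.smul ha₂)).add (hq₂.smul hb₂)).add (hA.smul hrest)
  · have e : (2 * η * c) • A + (y₁ • H₁ + y₂ • H₂) =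
        ((|y₁| - y₁) / 2) • (c • A - H₁) + ((|y₁| + y₁) / 2) • (c • A + H₁) + ((|y₂| - y₂) / 2) • (c • A - H₂) +
          ((|y₂| + y₂) / 2) • (c • A + H₂) + (2 * η * c - (|y₁| + |y₂|) * c) • A := by
      ext i j; simp [Matrix.add_apply, Matrix.sub_apply, Matrix.smul_apply]; ring
    rw [e]
    exact ((((hm₁.smul hb₁).add (hq₁.smul ha₁)).add (hm₂.smul hb₂)).add (hq₂.smul ha₂)).add (hA.smul hrest)

end Affine

/-! ## §4 (v1.1, appended) The lower comparison (L): the two-sided squeeze on the diagonal -/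

section Lower

variable {ν μ : Type*} [Fintype ν] [Fintype μ] [DecidableEq ν] [DecidableEq μ]
variable {A K : Matrix ν ν ℝ} {Q : Matrix μ ν ℝ}

open Summit.QuantumFields.BalabanUV.Beta.GAN24.DerivativeRateTransferAccretive (trial_dotProduct_minOp constraint_mulVec_minOp star_map_mulVec
  dotProduct_mulVec_comm_of_transpose star_ofReal)

/-- **(L) `re_effForm_accretive_diag_ge` — THE LOWER COMPARISON** [our proof; gan24-idea-1 g45's (L) over `ℂ`]: `A` PSD, `K` symmetric, `kkt(A,Q)` nonsingular ⟹
`𝒮_A(b,b) ≤ Re 𝒮_{Â+iK̂}(b,b)`.  (PART 35 (V): `Re 𝒮(b,b) = Re ū_b·Âu_b` for the complex minimiser `u_b`, which is `Q̂`-admissible; with the REAL minimiser `w_b = ℋ_Â e_b`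
and `d := u_b − w_b ∈ ker Q̂` — and `d̄ ∈ ker Q̂` BECAUSE `Q` is real — Euler–Lagrange kills both cross terms: `ū_b·Âu_b = w_b·Âw_b + d̄·Âd`, `Re d̄·Âd ≥ 0`.) -/
theorem re_effForm_accretive_diag_ge (hA : A.PosSemidef) (hK : Kᵀ = K) (h : IsUnit (kkt A Q).det) (b : μ) :
    effForm A Q b b ≤
      (effForm (A.map (Complex.ofRealHom : ℝ →+* ℂ) + Complex.I • K.map (Complex.ofRealHom : ℝ →+* ℂ)) (Q.map (Complex.ofRealHom : ℝ →+* ℂ)) b b).re := by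
  set Ac := A.map (Complex.ofRealHom : ℝ →+* ℂ) with hAc
  set Kc := K.map (Complex.ofRealHom : ℝ →+* ℂ) with hKc
  set Qc := Q.map (Complex.ofRealHom : ℝ →+* ℂ) with hQc
  have hAt : Aᵀ = A := transpose_eq_of_posSemidef hA
  have hAct : Acᵀ = Ac := by rw [hAc, transpose_map_ofReal, hAt]
  have hreal : IsUnit (kkt Ac Qc).det := by
    rw [hAc, hQc, Summit.QuantumFields.BalabanUV.Beta.GAN24.DerivativeRateTransferLoewnerEnd.kkt_map]
    exact Summit.QuantumFields.BalabanUV.Beta.GAN24.DerivativeRateTransferLoewnerEnd.isUnit_det_map _ _ h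
  have hM : IsUnit (kkt (Ac + Complex.I • Kc) Qc).det := isUnit_det_kkt_accretive hA hK h
  set u := minOp (Ac + Complex.I • Kc) Qc *ᵥ Pi.single b 1 with hu
  set w := minOp Ac Qc *ᵥ Pi.single b 1 with hw
  set wr : ν → ℝ := minOp A Q *ᵥ Pi.single b 1 with hwr
  have hwreal : w = fun i => (wr i : ℂ) := by rw [hw, hwr, hAc, hQc, minOp_map_single h b]
  have hwstar : star w = w := by rw [hwreal, star_ofReal]
  have huadm : Qc *ᵥ u = Pi.single b 1 := constraint_mulVec_minOp hM _
  have hwadm : Qc *ᵥ w = Pi.single b 1 := constraint_mulVec_minOp hreal _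
  -- `d := u − w` and its conjugate lie in `ker Q̂`
  have hd : Qc *ᵥ (u - w) = 0 := by rw [mulVec_sub, huadm, hwadm, sub_self]
  have hds : Qc *ᵥ star (u - w) = 0 := by rw [hQc, ← star_map_mulVec, ← hQc, hd, star_zero]
  -- Euler–Lagrange kills both cross terms
  have c1 : star (u - w) ⬝ᵥ (Ac *ᵥ w) = 0 := by rw [hw, trial_dotProduct_minOp hreal hds, zero_dotProduct]
  have c2 : star w ⬝ᵥ (Ac *ᵥ (u - w)) = 0 := by
    rw [hwstar, dotProduct_mulVec_comm_of_transpose hAct, hw, trial_dotProduct_minOp hreal hd, zero_dotProduct]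
  -- the split `ū·Âu = w̄·Âw + d̄·Âd`
  have hsplit : star u ⬝ᵥ (Ac *ᵥ u) = star w ⬝ᵥ (Ac *ᵥ w) + star (u - w) ⬝ᵥ (Ac *ᵥ (u - w)) := by
    have e : u = w + (u - w) := by abel
    conv_lhs => rw [e]
    rw [star_add, mulVec_add, add_dotProduct, dotProduct_add, dotProduct_add, c1, c2]
    ring
  -- the real diagonal value and the two real parts
  have hV : (effForm (Ac + Complex.I • Kc) Qc b b).re = (star u ⬝ᵥ (Ac *ᵥ u)).re := re_effForm_accretive_diag hK hM b
  have hww : star w ⬝ᵥ (Ac *ᵥ w) = ((effForm A Q b b : ℝ) : ℂ) := by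
    rw [hwstar, hwreal, ofReal_mulVec, ofReal_dotProduct, hwr, ← dotProduct_effForm_eq_energy h, single_dotProduct_mulVec_single]
  have hdd : 0 ≤ (star (u - w) ⬝ᵥ (Ac *ᵥ (u - w))).re := (Complex.nonneg_iff.mp ((posSemidef_map_ofReal hA).dotProduct_mulVec_nonneg (u - w))).1
  rw [hV, hsplit, Complex.add_re, hww, Complex.ofReal_re]
  linarith

end Lower

end Summit.QuantumFields.BalabanUV.Beta.GAN24.DerivativeRateTransferAccretiveBound

end
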